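import Summits.ResolutionOfSingularities.ResolutionOfSingularities.Theorems.WeightedInvariantContactCylinderEssSmooth
import Summits.ResolutionOfSingularities.ResolutionOfSingularities.Theorems.WeightedInvariantContactCylinderDefs
import Summits.ResolutionOfSingularities.ResolutionOfSingularities.Theorems.WeightedInvariantContactCylinderDescent
import HarnessLib

/-!
# (c11)≤3 for the flat centre filtration `J₃ᵗ = Iota3.jFlatT`, PART 2 — the CYLINDER VALUES over a regular pair / a regular
# parameter, and their compatibility with essentially smooth local homomorphisms WITHOUT the `b_max ≥ 1` / maximiser
# hypotheses (door `HypersurfaceCentreConstruction`, stmt-ResolutionOfSingularities-19897; P3 rung clause (c11)≤3, J-half of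
# `IotaJEssSmoothCompatibleLE 3 p Iota3.iotaFlatT Iota3.jFlatT`; ORDER (o53) of res-L1-w43-plan-1, hand res-L1-w43-stub-3)

Topic: `Summits/ResolutionOfSingularities/ResolutionOfSingularities/Theorems`. Helper for the door item
`HypersurfaceCentreConstruction` (stmt-ResolutionOfSingularities-19897, route `WeightedInvariant`), line `local-engine`
(L W4.3), def-free.  MEMO `L/res-L1-w43-stub-3/g5/O53-MEMO.md` §2 (A)(B).  brk-1/005's `cylinder_map_compatible` (p525507)
takes the P2 data at `S_P` as HYPOTHESES (`f/1` not of monomial type, a maximiser `g ∈ S` with independent differential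
reaching `b_max ≥ 1`); along the top `ι₀`-stratum of a door position only «not of monomial type» and «equimultiple» are
available, so THIS FILE removes the other two:

* §3 `cylinder_comap_eq_pow_of_bMax_le_one` — VALUE of the cylinder over a regular pair `𝔭 = (x, g)` when the terminal contact
  level of `f/1` in `R_𝔭` is `≤ 1` (the junk `b_max = 0` of an unbounded set of reached levels — a NON-excellent `R_𝔭`; (c11)
  quantifies over all regular local rings — included): every weight-`≤ 1` contact filtration is `𝔪_{R_𝔭}^•`, so the cylinder is
  `𝔭^m` (symbolic = ordinary power for a regular pair: brick `comap_map_weightedMonomialIdeal_eq_of_linearIndependent`, p521270);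
  `cylinder_comap_eq_pow_of_height_one` — VALUE over a regular parameter `𝔭 = (x)`: `f = b x^n`, `x ∤ b`, CASE A in `R_𝔭`
  (`jContact_of_eq_unit_mul_pow`, p516684) gives `(x/1)^m`, contracted to `𝔭^m`.
* §4 **`cylinderAt_jContact_pair_map_compatible`** — over a regular pair `P = (x, g₀)` whose quotient has the valuation
  dichotomy (`S ⧸ P` a DVR — the P3a curve — or a field — the point `P = 𝔪_S` of a surface germ mapped into a threefold germ),
  with `f ∈ P`, `f/1 ≠ 0` NOT of monomial type in `S_P` and EQUIMULTIPLE (`f ∉ 𝔪_S^{ν+1}`, `ν = ord_{S_P} f`):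
  `cylinderAt jContact S' (P S') (φ f) m = (cylinderAt jContact S P f m) S'`.  Proof by `b_max` (the same at `S_P` and at
  `S'_{P S'}`: `EssSmoothLevels.bMax_map_eq`, p518970, along the localised homomorphism, which has equal dimension `2` and
  `𝔪 ↦ 𝔪'` by `EssSmoothLE2.dims_of_not_isMonomialType`, p519712): `≤ 1` — §3 on both sides; `≥ 2` — a maximiser exists in
  `S_P` (`Nat.sSup_mem`, no excellence needed) and DESCENDS to a regular pair of `S` by brk-1/005's
  `ContactCylinder.Descent.exists_pair_reaches` (p532512's engine), after which `cylinder_map_compatible` applies verbatim.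
  **`cylinderAt_jContact_map_compatible_of_height_one`** — the divisorial case (`φ x ∉ 𝔪_{S'}²`, res-type-070's
  `mem_maximalIdeal_pow_iff_of_formallySmooth`; `φ` injective by faithful flatness).

[OURS · L1 W4.3 · (o53)]  Replaces the role of NO printed item; NOT a statement of the manuscript
[claim: Hironaka2017, status: under-review]. AI work, weaker than expert review.  Pure commutative algebra; no named facts.

## References

* H. Matsumura, *Commutative Ring Theory* (1987), Thm. 7.5, 13.5, 14.2, 14.3, 16.2, 23.7. [Matsumura1987]
* V. Cossart, U. Jannsen, S. Saito, LNM 2270 (2020), Ch. 8 (maximal contact in dimension two). [CossartJannsenSaito2020]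
-/

noncomputable section

open IsLocalRing Literature.AlgebraicGeometry.Resolution
open Summit.ResolutionOfSingularities.ResolutionOfSingularities.Cruxes.HypersurfaceCentreConstruction.LocalEngine

set_option linter.dupNamespace false -- mandated namespace of this single-conjunct summit

namespace Summit.ResolutionOfSingularities.ResolutionOfSingularities.Theorems

namespace JFlatEssSmooth

open ContactCylinder

/-! ## §3 Cylinder VALUES: terminal level `≤ 1` over a regular pair; a regular parameter -/

section Values

variable (R : Type) [CommRing R] [IsRegularLocalRing R]

/-- **VALUE of the cylinder over a regular pair when `b_max ≤ 1`** (`𝔭 = (x, g)` with independent differentials, `f/1 ≠ 0` a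
non-unit NOT of monomial type in `R_𝔭`, terminal contact level `b_max (f/1) ≤ 1` — the junk `0` of an unbounded set of reached
levels included): every contact filtration of weight `≤ 1` is `𝔪_{R_𝔭}^•`, so `jContact (R_𝔭) (f/1) m = 𝔪_{R_𝔭}^m` and
`(jContact (R_𝔭) (f/1) m) ∩ R = 𝔭^m` (symbolic power = ordinary power for a regular pair, brick
`comap_map_weightedMonomialIdeal_eq_of_linearIndependent`, p521270). [cite: Matsumura1987, Thm. 16.2] -/
theorem cylinder_comap_eq_pow_of_bMax_le_one (x g : R) (hxg : ∀ i, (![x, g] : Fin 2 → R) i ∈ maximalIdeal R)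
    (hli : LinearIndependent (ResidueField R) (fun i => (maximalIdeal R).toCotangent ⟨(![x, g] : Fin 2 → R) i, hxg i⟩))
    [(Ideal.span {x, g}).IsPrime] (f : R)
    (hf0 : algebraMap R (Localization.AtPrime (Ideal.span {x, g})) f ≠ 0)
    (hfu : ¬ IsUnit (algebraMap R (Localization.AtPrime (Ideal.span {x, g})) f))
    (hnm : ¬ IsMonomialType (algebraMap R (Localization.AtPrime (Ideal.span {x, g})) f))
    (hB : bMax (algebraMap R (Localization.AtPrime (Ideal.span {x, g})) f) ≤ 1) (m : ℕ) :
    (jContact (Localization.AtPrime (Ideal.span {x, g})) (algebraMap R (Localization.AtPrime (Ideal.span {x, g})) f) m).comap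
      (algebraMap R (Localization.AtPrime (Ideal.span {x, g}))) = Ideal.span {x, g} ^ m := by
  haveI : IsRegularLocalRing (Localization.AtPrime (Ideal.span {x, g})) :=
    isRegularLocalRing_localization_atPrime R (Ideal.span {x, g})
  -- `J = 𝔪^m` in `R_𝔭`
  have hJ : jContact (Localization.AtPrime (Ideal.span {x, g}))
      (algebraMap R (Localization.AtPrime (Ideal.span {x, g})) f) m =
      maximalIdeal (Localization.AtPrime (Ideal.span {x, g})) ^ m := by
    rw [jContact_eq, jContactLocal_of_not_isMonomialType hf0 hfu hnm]
    refine le_antisymm (sup_le le_rfl (iSup₂_le fun g' hg' => ?_)) le_sup_left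
    rcases Nat.le_one_iff_eq_zero_or_eq_one.mp hB with h0 | h1
    · rw [h0, contactFiltration_zero_weight]
    · rw [h1, contactFiltration_one_weight hg'.1]
  -- `𝔪^m = ((x, g; 1, 1)_m) R_𝔭`
  obtain ⟨hmax, -⟩ := span_pair_eq_maximalIdeal_atPrime_and_not_mem_sq R x g hxg hli
  have hx𝔭 : ∀ i, (![x, g] : Fin 2 → R) i ∈ Ideal.span {x, g} := fun i =>
    Ideal.subset_span (by fin_cases i <;> simp)
  have hvec : (fun i => algebraMap R (Localization.AtPrime (Ideal.span {x, g})) ((![x, g] : Fin 2 → R) i)) =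
      ![algebraMap R (Localization.AtPrime (Ideal.span {x, g})) x,
        algebraMap R (Localization.AtPrime (Ideal.span {x, g})) g] := by
    funext i; fin_cases i <;> rfl
  have hrange : Set.range (![x, g] : Fin 2 → R) = {x, g} := Matrix.range_cons_cons_empty x g ![]
  have hrange' : Set.range (![algebraMap R (Localization.AtPrime (Ideal.span {x, g})) x,
      algebraMap R (Localization.AtPrime (Ideal.span {x, g})) g] : Fin 2 → _) =
      {algebraMap R (Localization.AtPrime (Ideal.span {x, g})) x, algebraMap R (Localization.AtPrime (Ideal.span {x, g})) g} :=
    Matrix.range_cons_cons_empty _ _ ![]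
  have hQ : maximalIdeal (Localization.AtPrime (Ideal.span {x, g})) ^ m =
      (weightedMonomialIdeal ![x, g] (fun _ => 1) m).map (algebraMap R (Localization.AtPrime (Ideal.span {x, g}))) := by
    rw [← hmax, ← hrange', ← Theorems.weightedMonomialIdeal_one_eq_pow, weightedMonomialIdeal_map, hvec]
  rw [hJ, hQ]
  rcases Nat.eq_zero_or_pos m with rfl | hm
  · rw [weightedMonomialIdeal_zero, Ideal.map_top, Ideal.comap_top, pow_zero, Ideal.one_eq_top]
  · rw [comap_map_weightedMonomialIdeal_eq_of_linearIndependent (Ideal.span {x, g}) ![x, g] hxg hli hx𝔭 (fun _ => 1)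
      (fun _ => Nat.one_pos) hm, Theorems.weightedMonomialIdeal_one_eq_pow, hrange]

/-- **VALUE of the cylinder over a regular parameter** (`𝔭 = (x)`, `x ∈ 𝔪 ∖ 𝔪²`, `0 ≠ f ∈ 𝔭`): `f = b · x^n` with `x ∤ b`,
`n ≥ 1`, so `f/1 = (b/1) (x/1)^n` is of monomial type in the discrete valuation ring `R_𝔭` with `b/1` a unit, CASE A gives
`jContact (R_𝔭) (f/1) m = (x/1)^m`, and `(x/1)^m R_𝔭 ∩ R = (x^m)`. [cite: Matsumura1987, Thm. 14.3, Thm. 16.2] -/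
theorem cylinder_comap_eq_pow_of_height_one (x : R) (hx : x ∈ maximalIdeal R) (hx2 : x ∉ maximalIdeal R ^ 2)
    [(Ideal.span {x}).IsPrime] (f : R) (hf0 : f ≠ 0) (hfx : f ∈ Ideal.span {x}) (m : ℕ) :
    (jContact (Localization.AtPrime (Ideal.span {x})) (algebraMap R (Localization.AtPrime (Ideal.span {x})) f) m).comap
      (algebraMap R (Localization.AtPrime (Ideal.span {x}))) = Ideal.span {x} ^ m := by
  haveI := isDomain_of_isRegularLocalRing R
  haveI : IsRegularLocalRing (Localization.AtPrime (Ideal.span {x})) :=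
    isRegularLocalRing_localization_atPrime R (Ideal.span {x})
  have hprime : Prime x := IsRegularLocalRing.prime_of_not_mem_sq hx hx2
  -- `f = x^n · b`, `x ∤ b`
  obtain ⟨n, b, hxb, rfl⟩ := WfDvdMonoid.max_power_factor hf0 hprime.irreducible
  have hn : 1 ≤ n := by
    rcases Nat.eq_zero_or_pos n with rfl | hn
    · rw [pow_zero, one_mul] at hfx
      exact absurd (Ideal.mem_span_singleton.mp hfx) hxb
    · exact hn
  -- the single vector `![x]`
  have hx𝔪 : ∀ i, (![x] : Fin 1 → R) i ∈ maximalIdeal R := fun i => by fin_cases i; exact hx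
  have hlix : LinearIndependent (ResidueField R) (fun i => (maximalIdeal R).toCotangent ⟨(![x] : Fin 1 → R) i, hx𝔪 i⟩) := by
    rw [linearIndependent_unique_iff]
    intro h
    exact hx2 ((Ideal.toCotangent_eq_zero _ _).mp h)
  have hx𝔭 : ∀ i, (![x] : Fin 1 → R) i ∈ Ideal.span {x} := fun i => by
    fin_cases i; exact Ideal.mem_span_singleton_self x
  have hrange : Set.range (![x] : Fin 1 → R) = {x} := by
    ext y; simp [eq_comm]
  have hvec : (fun i => algebraMap R (Localization.AtPrime (Ideal.span {x})) ((![x] : Fin 1 → R) i)) =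
      ![algebraMap R (Localization.AtPrime (Ideal.span {x})) x] := by
    funext i; fin_cases i; rfl
  have hrange' : Set.range (![algebraMap R (Localization.AtPrime (Ideal.span {x})) x] : Fin 1 → _) =
      {algebraMap R (Localization.AtPrime (Ideal.span {x})) x} := by
    ext y; simp
  -- powers of `𝔭` are contracted from `R_𝔭`
  have hpow : ∀ {k : ℕ}, 1 ≤ k →
      ((Ideal.span {algebraMap R (Localization.AtPrime (Ideal.span {x})) x}) ^ k).comap
        (algebraMap R (Localization.AtPrime (Ideal.span {x}))) = Ideal.span {x} ^ k := by
    intro k hk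
    rw [← hrange', ← Theorems.weightedMonomialIdeal_one_eq_pow, ← hvec, ← weightedMonomialIdeal_map,
      comap_map_weightedMonomialIdeal_eq_of_linearIndependent (Ideal.span {x}) ![x] hx𝔪 hlix hx𝔭 (fun _ => 1)
        (fun _ => Nat.one_pos) hk, Theorems.weightedMonomialIdeal_one_eq_pow, hrange]
  -- `x/1 ∈ 𝔪_𝔭 ∖ 𝔪_𝔭²`, `b/1` a unit
  have hmax : maximalIdeal (Localization.AtPrime (Ideal.span {x})) =
      Ideal.span {algebraMap R (Localization.AtPrime (Ideal.span {x})) x} := by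
    rw [← Localization.AtPrime.map_eq_maximalIdeal, Ideal.map_span, Set.image_singleton]
  have hxmem : algebraMap R (Localization.AtPrime (Ideal.span {x})) x ∈ maximalIdeal (Localization.AtPrime (Ideal.span {x})) := by
    rw [hmax]; exact Ideal.mem_span_singleton_self _
  have hx2' : algebraMap R (Localization.AtPrime (Ideal.span {x})) x ∉
      maximalIdeal (Localization.AtPrime (Ideal.span {x})) ^ 2 := by
    intro h
    rw [hmax, ← Ideal.mem_comap, hpow one_le_two] at h
    exact hx2 (Ideal.pow_right_mono (Ideal.span_le.mpr (Set.singleton_subset_iff.mpr hx)) 2 h)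
  have hbunit : IsUnit (algebraMap R (Localization.AtPrime (Ideal.span {x})) b) := by
    apply IsLocalization.map_units (Localization.AtPrime (Ideal.span {x})) (⟨b, ?_⟩ : (Ideal.span {x}).primeCompl)
    exact fun h => hxb (Ideal.mem_span_singleton.mp h)
  -- CASE A in `R_𝔭`, then contract
  rw [map_mul, map_pow, mul_comm, jContact_of_eq_unit_mul_pow (Localization.AtPrime (Ideal.span {x})) hbunit hxmem hx2' hn m]
  rcases Nat.eq_zero_or_pos m with rfl | hm
  · rw [pow_zero, pow_zero, Ideal.one_eq_top, Ideal.one_eq_top, Ideal.comap_top]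
  · exact hpow hm

end Values

/-! ## §4 The cylinder values are compatible with essentially smooth local homomorphisms -/

section Compatible

variable (S S' : Type) [CommRing S] [IsRegularLocalRing S] [CommRing S'] [IsRegularLocalRing S'] [Algebra S S']
  [IsLocalHom (algebraMap S S')] [Algebra.FormallySmooth S S'] [Algebra.EssFiniteType S S']

/-- **THE CYLINDER OVER A REGULAR PAIR IS COMPATIBLE WITH ESSENTIALLY SMOOTH LOCAL HOMOMORPHISMS.**  `φ : S → S'` local,
formally smooth, essentially of finite type between regular local rings; `P = (x, g₀)` a prime of `S` generated by a pair with
independent differentials whose quotient has the valuation dichotomy (`S ⧸ P` a discrete valuation ring, or a field); `f ∈ P` with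
`f/1 ≠ 0` NOT of monomial type in `S_P` and EQUIMULTIPLE along `P` (`f ∉ 𝔪_S^{ν+1}`, `ν = ord_{S_P} f`).  Then for every `m`
`cylinderAt jContact S' (P S') (φ f) m = (cylinderAt jContact S P f m) S'`.  By the terminal level `b_max` of `f/1` (the same in
`S_P` and `S'_{P S'}`, `EssSmoothLevels.bMax_map_eq` p518970 along the localised homomorphism): `b_max ≤ 1` — both cylinders are
`P^m` / `(P S')^m` (`cylinder_comap_eq_pow_of_bMax_le_one`); `b_max ≥ 2` — a maximiser of `S_P` DESCENDS to a regular pair of `S`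
(brk-1/005 `ContactCylinder.Descent.exists_pair_reaches`) and `cylinder_map_compatible` (p525507) applies verbatim.
[OURS · L1 W4.3 · (o53) · (c11) J-side, cylinder regimes] -/
theorem cylinderAt_jContact_pair_map_compatible (P : Ideal S) [P.IsPrime] (x g₀ : S)
    (hxg : ∀ i, (![x, g₀] : Fin 2 → S) i ∈ maximalIdeal S)
    (hli : LinearIndependent (ResidueField S) (fun i => (maximalIdeal S).toCotangent ⟨(![x, g₀] : Fin 2 → S) i, hxg i⟩))
    (hP : Ideal.span {x, g₀} = P)
    (hval : ∀ a b : S, b ∉ P → ∃ c : S, a - b * c ∈ P ∨ (c ∈ maximalIdeal S ∧ b - a * c ∈ P))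
    (f : S) (hf0 : algebraMap S (Localization.AtPrime P) f ≠ 0) (hfP : f ∈ P)
    (hnm : ¬ IsMonomialType (algebraMap S (Localization.AtPrime P) f))
    (heq : f ∉ maximalIdeal S ^ ((adicOrder (algebraMap S (Localization.AtPrime P) f)).toNat + 1))
    (P' : Ideal S') [P'.IsPrime] (hPP' : P.map (algebraMap S S') = P') (m : ℕ) :
    cylinderAt jContact S' P' (algebraMap S S' f) m = (cylinderAt jContact S P f m).map (algebraMap S S') := by
  classical
  by_cases hB : bMax (algebraMap S (Localization.AtPrime P) f) ≤ 1
  · -- `b_max ≤ 1`: both cylinders are powers of the pair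
    subst hP
    have hP'eq : Ideal.span {algebraMap S S' x, algebraMap S S' g₀} = P' := by rw [span_pair_map_eq_map, hPP']
    subst hP'eq
    haveI : IsRegularLocalRing (Localization.AtPrime (Ideal.span {x, g₀})) :=
      isRegularLocalRing_localization_atPrime S _
    haveI : IsRegularLocalRing (Localization.AtPrime (Ideal.span {algebraMap S S' x, algebraMap S S' g₀})) :=
      isRegularLocalRing_localization_atPrime S' _
    have hxg' := pair_map_mem_maximalIdeal S S' x g₀ hxg
    have hli' := linearIndependent_toCotangent_pair_map S S' x g₀ hxg hli
    have hfu : ¬ IsUnit (algebraMap S (Localization.AtPrime (Ideal.span {x, g₀})) f) := fun h =>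
      ((IsLocalization.AtPrime.isUnit_to_map_iff (Localization.AtPrime (Ideal.span {x, g₀})) (Ideal.span {x, g₀}) f).mp h) hfP
    have hfm : algebraMap S (Localization.AtPrime (Ideal.span {x, g₀})) f ∈ maximalIdeal (Localization.AtPrime (Ideal.span {x, g₀})) :=
      (IsLocalRing.mem_maximalIdeal _).mpr hfu
    -- the localised homomorphism `ψ : S_P → S'_{P'}`
    have h𝔭𝔭' : Ideal.span {x, g₀} =
        (Ideal.span {algebraMap S S' x, algebraMap S S' g₀}).comap (algebraMap S S') :=
      (comap_span_pair_map S S' x g₀).symm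
    letI : Algebra (Localization.AtPrime (Ideal.span {x, g₀}))
        (Localization.AtPrime (Ideal.span {algebraMap S S' x, algebraMap S S' g₀})) :=
      (Localization.localRingHom (Ideal.span {x, g₀}) (Ideal.span {algebraMap S S' x, algebraMap S S' g₀})
        (algebraMap S S') h𝔭𝔭').toAlgebra
    haveI : IsScalarTower S (Localization.AtPrime (Ideal.span {x, g₀}))
        (Localization.AtPrime (Ideal.span {algebraMap S S' x, algebraMap S S' g₀})) :=
      IsScalarTower.of_algebraMap_eq fun s => by
        change _ = Localization.localRingHom (Ideal.span {x, g₀}) (Ideal.span {algebraMap S S' x, algebraMap S S' g₀})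
          (algebraMap S S') h𝔭𝔭' (algebraMap S _ s)
        rw [Localization.localRingHom_to_map,
          IsScalarTower.algebraMap_apply S S' (Localization.AtPrime (Ideal.span {algebraMap S S' x, algebraMap S S' g₀}))]
    haveI : IsLocalHom (algebraMap (Localization.AtPrime (Ideal.span {x, g₀}))
        (Localization.AtPrime (Ideal.span {algebraMap S S' x, algebraMap S S' g₀}))) :=
      Localization.isLocalHom_localRingHom _ _ _ h𝔭𝔭'
    haveI : Algebra.FormallySmooth S (Localization.AtPrime (Ideal.span {algebraMap S S' x, algebraMap S S' g₀})) :=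
      Algebra.FormallySmooth.comp S S' _
    haveI : Algebra.EssFiniteType S (Localization.AtPrime (Ideal.span {algebraMap S S' x, algebraMap S S' g₀})) :=
      Algebra.EssFiniteType.comp S S' _
    haveI : Algebra.FormallySmooth (Localization.AtPrime (Ideal.span {x, g₀}))
        (Localization.AtPrime (Ideal.span {algebraMap S S' x, algebraMap S S' g₀})) :=
      Algebra.FormallySmooth.localization_base (Ideal.span {x, g₀}).primeCompl
    haveI : Algebra.EssFiniteType (Localization.AtPrime (Ideal.span {x, g₀}))
        (Localization.AtPrime (Ideal.span {algebraMap S S' x, algebraMap S S' g₀})) :=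
      Algebra.EssFiniteType.of_comp S _ _
    have hfT : algebraMap S' (Localization.AtPrime (Ideal.span {algebraMap S S' x, algebraMap S S' g₀})) (algebraMap S S' f) =
        algebraMap (Localization.AtPrime (Ideal.span {x, g₀})) _
          (algebraMap S (Localization.AtPrime (Ideal.span {x, g₀})) f) := by
      rw [← IsScalarTower.algebraMap_apply S S' _ f,
        IsScalarTower.algebraMap_apply S (Localization.AtPrime (Ideal.span {x, g₀})) _ f]
    -- dimensions and `𝔪 ↦ 𝔪'` along `ψ`
    have hdimT := ringKrullDim_atPrime_span_pair_le_two (R := S') (algebraMap S S' x) (algebraMap S S' g₀)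
    obtain ⟨hS2, hT2, h𝔪⟩ := EssSmoothLE2.dims_of_not_isMonomialType (Localization.AtPrime (Ideal.span {x, g₀}))
      (Localization.AtPrime (Ideal.span {algebraMap S S' x, algebraMap S S' g₀})) hdimT hf0 hfu hnm
    have hf0' : algebraMap S' (Localization.AtPrime (Ideal.span {algebraMap S S' x, algebraMap S S' g₀})) (algebraMap S S' f) ≠ 0 := by
      rw [hfT]
      exact fun h => hf0 (EssSmoothDescent.algebraMap_injective
        (S := Localization.AtPrime (Ideal.span {x, g₀}))
        (S' := Localization.AtPrime (Ideal.span {algebraMap S S' x, algebraMap S S' g₀})) (by rw [h, map_zero]))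
    have hfu' : ¬ IsUnit (algebraMap S' (Localization.AtPrime (Ideal.span {algebraMap S S' x, algebraMap S S' g₀}))
        (algebraMap S S' f)) := by
      rw [hfT]
      exact fun h => hfu ((isUnit_map_iff _ _).mp h)
    have hnm' : ¬ IsMonomialType (algebraMap S' (Localization.AtPrime (Ideal.span {algebraMap S S' x, algebraMap S S' g₀}))
        (algebraMap S S' f)) := by
      rw [hfT]
      exact fun h => hnm (EssSmoothDescent.isMonomialType_of_map h𝔪 hS2 hT2 h)
    have hB' : bMax (algebraMap S' (Localization.AtPrime (Ideal.span {algebraMap S S' x, algebraMap S S' g₀}))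
        (algebraMap S S' f)) ≤ 1 := by
      rw [hfT, EssSmoothLevels.bMax_map_eq h𝔪 hS2 hT2 hf0 hfm]
      exact hB
    rw [cylinderAt_def, cylinderAt_def, cylinder_comap_eq_pow_of_bMax_le_one S x g₀ hxg hli f hf0 hfu hnm hB m,
      cylinder_comap_eq_pow_of_bMax_le_one S' (algebraMap S S' x) (algebraMap S S' g₀) hxg' hli' (algebraMap S S' f)
        hf0' hfu' hnm' hB' m, Ideal.map_pow, span_pair_map_eq_map]
  · -- `b_max ≥ 2`: a maximiser exists and descends to a regular pair of `S`
    have hb : 1 ≤ bMax (algebraMap S (Localization.AtPrime P) f) := by omega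
    have hmem : bMax (algebraMap S (Localization.AtPrime P) f) ∈
        {b : ℕ | 1 ≤ b ∧ Reaches (algebraMap S (Localization.AtPrime P) f)
          (adicOrder (algebraMap S (Localization.AtPrime P) f)).toNat b} := by
      have hB' : sSup {b : ℕ | 1 ≤ b ∧ Reaches (algebraMap S (Localization.AtPrime P) f)
          (adicOrder (algebraMap S (Localization.AtPrime P) f)).toNat b} = bMax (algebraMap S (Localization.AtPrime P) f) := by
        rw [bMax_def]
      have hne : {b : ℕ | 1 ≤ b ∧ Reaches (algebraMap S (Localization.AtPrime P) f)
          (adicOrder (algebraMap S (Localization.AtPrime P) f)).toNat b}.Nonempty := by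
        by_contra h
        rw [Set.not_nonempty_iff_eq_empty] at h
        rw [h, csSup_empty] at hB'
        exact absurd hB' (by change ¬ (0 = bMax _); omega)
      have hbdd : BddAbove {b : ℕ | 1 ≤ b ∧ Reaches (algebraMap S (Localization.AtPrime P) f)
          (adicOrder (algebraMap S (Localization.AtPrime P) f)).toNat b} := by
        by_contra h
        rw [csSup_of_not_bddAbove h, csSup_empty] at hB'
        exact absurd hB' (by change ¬ (0 = bMax _); omega)
      rw [← hB']
      exact Nat.sSup_mem hne hbdd
    obtain ⟨-, hreach⟩ := hmem
    obtain ⟨x', g', hP', hxg', hli', hreach'⟩ :=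
      Descent.exists_pair_reaches P hval hxg hli hP hf0 hnm heq hb hreach
    subst hP'
    have hP'eq : Ideal.span {algebraMap S S' x', algebraMap S S' g'} = P' := by rw [span_pair_map_eq_map, hPP']
    subst hP'eq
    rw [cylinderAt_def, cylinderAt_def, ← IsScalarTower.algebraMap_apply S S' _ f]
    exact cylinder_map_compatible S S' x' g' hxg' hli' f hf0 hnm hreach' hb m

/-- **THE CYLINDER OVER A REGULAR PARAMETER IS COMPATIBLE WITH ESSENTIALLY SMOOTH LOCAL HOMOMORPHISMS** (divisorial case,
`P = (x)`, `x ∈ 𝔪 ∖ 𝔪²`, `0 ≠ f ∈ P`): `cylinderAt jContact S' (P S') (φ f) m = (cylinderAt jContact S P f m) S'` — both sides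
are `P^m` / `(φ x)^m` by `cylinder_comap_eq_pow_of_height_one` (`φ x ∉ 𝔪_{S'}²` by res-type-070's
`mem_maximalIdeal_pow_iff_of_formallySmooth`; `φ` injective by faithful flatness). [OURS · L1 W4.3 · (o53) · (c11) J-side, DIV] -/
theorem cylinderAt_jContact_map_compatible_of_height_one (P : Ideal S) [P.IsPrime] (x : S) (hx : x ∈ maximalIdeal S)
    (hx2 : x ∉ maximalIdeal S ^ 2) (hP : Ideal.span {x} = P) (f : S) (hf0 : f ≠ 0) (hfP : f ∈ P)
    (P' : Ideal S') [P'.IsPrime] (hPP' : P.map (algebraMap S S') = P') (m : ℕ) :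
    cylinderAt jContact S' P' (algebraMap S S' f) m = (cylinderAt jContact S P f m).map (algebraMap S S') := by
  subst hP
  have hP'eq : Ideal.span {algebraMap S S' x} = P' := by rw [← hPP', Ideal.map_span, Set.image_singleton]
  subst hP'eq
  have hx' : algebraMap S S' x ∈ maximalIdeal S' := map_nonunit (algebraMap S S') x hx
  have hx2' : algebraMap S S' x ∉ maximalIdeal S' ^ 2 := fun h =>
    hx2 ((IotaOrderEssSmooth.mem_maximalIdeal_pow_iff_of_formallySmooth S S' 2 x).mpr h)
  have hf0' : algebraMap S S' f ≠ 0 := fun h =>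
    hf0 (EssSmoothDescent.algebraMap_injective (S := S) (S' := S') (by rw [h, map_zero]))
  have hfP' : algebraMap S S' f ∈ Ideal.span {algebraMap S S' x} := by
    rw [← Set.image_singleton, ← Ideal.map_span]
    exact Ideal.mem_map_of_mem _ hfP
  rw [cylinderAt_def, cylinderAt_def, cylinder_comap_eq_pow_of_height_one S x hx hx2 f hf0 hfP m,
    cylinder_comap_eq_pow_of_height_one S' (algebraMap S S' x) hx' hx2' (algebraMap S S' f) hf0' hfP' m,
    Ideal.map_pow, Ideal.map_span, Set.image_singleton]

end Compatible

end JFlatEssSmooth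

end Summit.ResolutionOfSingularities.ResolutionOfSingularities.Theorems

end
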